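import Summits.Ventures.YMGap.RobustBall.ZTwoLayerIsing
import Summits.Ventures.YMGap.RobustBall.IsingStarDecay
import Literature.Probability.LatticeModels.GaussianPairingBoundCouplings
import HarnessLib

/-!
# RobustBall/ZTwoLayerGraph — the layer GRAPH of the centre-projected `ℤ₂` theory (degree `2(d−1)`, triangle-free for `L ≥ 4`), the
# ferromagnetic comparison system as the tree's `isingTwoPoint`, and the STAR-RATE two-point bound `(2(d−1)(2d−3) tanh²(2|β|))^{⌊dist_j/2⌋}`

HONEST FRAMING: venture file of the cell `pub-ymgap` (QuantumFields programme), track Y2 ROBUST-BALL / DS seat ds-4 (g9).  Finite sums on a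
finite torus; no `SU(2)` measure here; nothing about the continuum.  `ZTwoLayerIsing` bounds the rung two-point function of the
block-conditioned `ℤ₂` layer (no twist defect, `N = 2`) by the FERROMAGNETIC Ising correlation `⟨σ_bσ_t⟩` at the uniform coupling `2|β|` on the
plaquette-indexed pair structure of the selected layers.  Here that structure is a GRAPH on the sites of the torus (`layerGraph i H`: `y ∼ y ± e_v`,
`v ≠ i`, at the selected `i`-heights), the Friedli–Velenik average is identified with the tree's `isingTwoPoint (layerGraph i H) univ (2|β|) 0 free`
(`gksExpect_const_eq_isingTwoPoint`), the graph has degrees `≤ 2(d−1)` (`card_neighborFinset_layerGraph_le`) and no triangles when `L ≥ 4`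
(`layerGraph_triangle_free`), and `dist_j` is `1`-Lipschitz along it; so `IsingStarDecay` gives
**`norm_cavg_ψ_two_le_starRate_pow`**: `‖E ψ₂(σ_b − σ_t)‖ ≤ (2(d−1)(2d−3) tanh²(2|β|))^{⌊dist_j(t,b)/2⌋}` for EVERY selected set, transverse and
frozen configuration and background `U` — the per-rung input of `ZNFluxGenPeeling`.  STAR RATE vs the Dobrushin rate `2(d−1)·2|β|` of gen 7:
for `SU(2)`, `d = 4` the window `30 tanh²β_W < 1` (`β_W < 0.1846`) replaces `6 β_W < 1`.
-/

noncomputable section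

open Finset
open Literature.MathematicalPhysics.QuantumFieldTheory

namespace Summit.Ventures.YMGap.RobustBall

namespace ZTwo

open ZN ZNFluxW

variable {d L : ℕ} [NeZero L]

/-! ### The layer graph -/

/-- The direction of a plaquette other than `i`. [folklore] -/
def otherDir (i : Fin d) (p : Plaquette d L) : Fin d := if p.2.1.1 = i then p.2.1.2 else p.2.1.1

omit [NeZero L] in
/-- The other direction differs from `i` (for a plaquette with a side of direction `i`). [folklore] -/
theorem otherDir_ne (i : Fin d) (p : Plaquette d L) (hp : p.2.1.1 = i ∨ p.2.1.2 = i) : otherDir i p ≠ i := by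
  obtain ⟨z, ⟨⟨a, b⟩, hab⟩⟩ := p
  have hne : a ≠ b := (show a < b from hab).ne
  unfold otherDir
  simp only at hp ⊢
  split_ifs with h
  · exact fun hb => hne (h.trans hb.symm)
  · rcases hp with h' | h'
    · exact absurd h' h
    · exact fun ha => hne (ha.trans h'.symm)

omit [NeZero L] in
/-- `iSites i p = {p.1, p.1 + e_{otherDir}}` for a plaquette with a side of direction `i`. [folklore] -/
theorem iSites_eq_pair (i : Fin d) (p : Plaquette d L) (hp : p.2.1.1 = i ∨ p.2.1.2 = i) :
    iSites i p = {p.1, p.1.shift (otherDir i p)} := by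
  obtain ⟨z, ⟨⟨a, b⟩, hab⟩⟩ := p
  have hne : a ≠ b := (show a < b from hab).ne
  unfold otherDir iSites
  simp only at hp ⊢
  rcases hp with rfl | rfl
  · simp
  · simp only [hne, if_false, if_true]
    exact Finset.pair_comm _ _

/-- The layer relation: `y` is the base point and `y'` the shifted `i`-link of a plaquette at a selected height. [folklore] -/
def layerRel (i : Fin d) (H : Finset (ZMod L)) (y y' : Site d L) : Prop :=
  ∃ p ∈ layerPlaqs i H, y = p.1 ∧ y' = p.1.shift (otherDir i p)

/-- The layer relation is decidable. [folklore] -/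
instance (i : Fin d) (H : Finset (ZMod L)) : DecidableRel (layerRel i H) := fun y y' => by
  unfold layerRel; exact inferInstance

/-- **The layer graph**: `y ∼ y'` iff `{y, y'}` is the pair of `i`-links of a plaquette at a selected `i`-height. [folklore] -/
def layerGraph (i : Fin d) (H : Finset (ZMod L)) : SimpleGraph (Site d L) := SimpleGraph.fromRel (layerRel i H)

/-- Adjacency in the layer graph is decidable. [folklore] -/
instance (i : Fin d) (H : Finset (ZMod L)) : DecidableRel (layerGraph i H).Adj := fun y y' =>
  decidable_of_iff _ (SimpleGraph.fromRel_adj (layerRel i H) y y').symm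

/-- Adjacency in the layer graph. [folklore] -/
theorem layerGraph_adj {i : Fin d} {H : Finset (ZMod L)} {y y' : Site d L} :
    (layerGraph i H).Adj y y' ↔ y ≠ y' ∧ (layerRel i H y y' ∨ layerRel i H y' y) := SimpleGraph.fromRel_adj _ _ _

omit [NeZero L] in
/-- `z.shift v = y ↔ z = y − e_v`. [folklore] -/
theorem shift_eq_iff (z y : Site d L) (v : Fin d) : z.shift v = y ↔ z = y - Pi.single v 1 := by
  constructor
  · intro h; rw [← h]; simp [Site.shift]
  · intro h; rw [h]; simp [Site.shift]

/-- **Degrees of the layer graph are `≤ 2(d−1)`**: the neighbours of `y` are among `y ± e_v`, `v ≠ i`. [folklore] -/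
theorem card_neighborFinset_layerGraph_le (i : Fin d) (H : Finset (ZMod L)) (y : Site d L) :
    ((layerGraph i H).neighborFinset y).card ≤ 2 * (d - 1) := by
  classical
  have hsub : (layerGraph i H).neighborFinset y ⊆
      (Finset.univ.filter (fun v : Fin d => v ≠ i)).biUnion (fun v => {y.shift v, y - Pi.single v 1}) := by
    intro y' hy'
    rw [SimpleGraph.mem_neighborFinset, layerGraph_adj] at hy'
    obtain ⟨-, h⟩ := hy'
    rw [Finset.mem_biUnion]
    rcases h with ⟨p, hp, rfl, rfl⟩ | ⟨p, hp, rfl, h2⟩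
    · exact ⟨otherDir i p, Finset.mem_filter.2 ⟨Finset.mem_univ _, otherDir_ne i p (mem_layerPlaqs.1 hp).1⟩, by simp⟩
    · refine ⟨otherDir i p, Finset.mem_filter.2 ⟨Finset.mem_univ _, otherDir_ne i p (mem_layerPlaqs.1 hp).1⟩, ?_⟩
      rw [Finset.mem_insert, Finset.mem_singleton]
      exact Or.inr ((shift_eq_iff _ _ _).1 h2.symm)
  refine (Finset.card_le_card hsub).trans ((Finset.card_biUnion_le).trans ?_)
  calc ∑ v ∈ Finset.univ.filter (fun v : Fin d => v ≠ i), ({y.shift v, y - Pi.single v 1} : Finset (Site d L)).card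
      ≤ ∑ _v ∈ Finset.univ.filter (fun v : Fin d => v ≠ i), 2 := Finset.sum_le_sum fun v _ => Finset.card_le_two
    _ = 2 * (d - 1) := by
        rw [Finset.sum_const, smul_eq_mul, Finset.filter_ne' Finset.univ i, Finset.card_erase_of_mem (Finset.mem_univ i),
          Finset.card_univ, Fintype.card_fin, mul_comm]

/-- Adjacent sites differ by a signed unit vector in a direction `≠ i`. [folklore] -/
theorem exists_single_of_adj {i : Fin d} {H : Finset (ZMod L)} {y y' : Site d L} (h : (layerGraph i H).Adj y y') :
    ∃ v : Fin d, v ≠ i ∧ ∃ ε : ZMod L, (ε = 1 ∨ ε = -1) ∧ y' = y + Pi.single v ε := by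
  obtain ⟨-, h⟩ := layerGraph_adj.1 h
  rcases h with ⟨p, hp, rfl, rfl⟩ | ⟨p, hp, rfl, rfl⟩
  · exact ⟨otherDir i p, otherDir_ne i p (mem_layerPlaqs.1 hp).1, 1, Or.inl rfl, rfl⟩
  · refine ⟨otherDir i p, otherDir_ne i p (mem_layerPlaqs.1 hp).1, -1, Or.inr rfl, ?_⟩
    simp [Site.shift, add_assoc, ← Pi.single_add]

omit [NeZero L] in
/-- In `ℤ/L` with `L ≥ 4`: `1 ≠ 0` and `3 ≠ 0` (and so `2 ≠ ±1`, `0 ≠ ±1`, `−2 ≠ ±1`). [folklore] -/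
theorem one_ne_zero_and_three_ne_zero (hL : 4 ≤ L) : (1 : ZMod L) ≠ 0 ∧ (3 : ZMod L) ≠ 0 := by
  constructor
  · haveI : Fact (1 < L) := ⟨by omega⟩
    exact one_ne_zero
  · intro h
    have h3 : ((3 : ℕ) : ZMod L) = 0 := by exact_mod_cast h
    rw [ZMod.natCast_eq_zero_iff] at h3
    exact absurd (Nat.le_of_dvd (by norm_num) h3) (by omega)

/-- **The layer graph is triangle-free** (`L ≥ 4`): `y ∼ x`, `y ∼ x'` ⇒ `x ≁ x'` (two signed unit steps never make one unless `L ∣ 3`). [folklore] -/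
theorem layerGraph_triangle_free (hL : 4 ≤ L) (i : Fin d) (H : Finset (ZMod L)) (a x y : Site d L)
    (hax : (layerGraph i H).Adj a x) (hay : (layerGraph i H).Adj a y) : ¬(layerGraph i H).Adj x y := by
  intro hxy
  obtain ⟨h10, h30⟩ := one_ne_zero_and_three_ne_zero hL
  obtain ⟨v, -, ε₁, hε₁, hx⟩ := exists_single_of_adj hax
  obtain ⟨w, -, ε₂, hε₂, hy⟩ := exists_single_of_adj hay
  obtain ⟨u, -, ε₃, hε₃, hxy'⟩ := exists_single_of_adj hxy
  -- `ε₂ e_w = ε₁ e_v + ε₃ e_u`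
  have key : (Pi.single w ε₂ : Site d L) = Pi.single v ε₁ + Pi.single u ε₃ := by
    have := hxy'; rw [hx, hy, add_assoc] at this; exact add_left_cancel this
  have hε0 : ∀ ε : ZMod L, (ε = 1 ∨ ε = -1) → ε ≠ 0 := by
    rintro ε (rfl | rfl)
    · exact h10
    · rw [neg_ne_zero]; exact h10
  by_cases huv : u = v
  · subst huv
    by_cases huw : u = w
    · subst huw
      have h := congrFun key u
      simp only [Pi.add_apply, Pi.single_eq_same] at h
      -- `ε₂ = ε₁ + ε₃` with all three `±1`
      rcases hε₁ with rfl | rfl <;> rcases hε₂ with rfl | rfl <;> rcases hε₃ with rfl | rfl <;>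
        first
        | exact h10 (by linear_combination h)
        | exact h10 (by linear_combination -h)
        | exact h30 (by linear_combination h)
        | exact h30 (by linear_combination -h)
    · have h := congrFun key w
      simp only [Pi.add_apply, Pi.single_eq_same, Pi.single_eq_of_ne (Ne.symm huw) , add_zero] at h
      exact hε0 ε₂ hε₂ h
  · by_cases huw : u = w
    · subst huw
      have h := congrFun key v
      simp only [Pi.add_apply, Pi.single_eq_same, Pi.single_eq_of_ne (Ne.symm huv), add_zero] at h
      exact hε0 ε₁ hε₁ h.symm
    · have h := congrFun key u
      simp only [Pi.add_apply, Pi.single_eq_same, Pi.single_eq_of_ne huw, Pi.single_eq_of_ne huv, zero_add] at h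
      exact hε0 ε₃ hε₃ h.symm

/-- `dist_j` is `1`-Lipschitz along the layer graph. [folklore] -/
theorem jDist_le_of_adj {i : Fin d} {H : Finset (ZMod L)} (j : Fin d) (t : Site d L) {y y' : Site d L}
    (h : (layerGraph i H).Adj y y') : jDist j t y ≤ jDist j t y' + 1 := by
  obtain ⟨-, h⟩ := layerGraph_adj.1 h
  rcases h with ⟨p, -, rfl, rfl⟩ | ⟨p, -, rfl, rfl⟩
  · exact jDist_le_shift j t _ _
  · exact jDist_shift_le j t _ _

/-! ### The ferromagnetic comparison system is the tree's Ising model on the layer graph -/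

/-- The edge of the layer graph carried by a plaquette. [folklore] -/
def edgeOf (i : Fin d) (p : Plaquette d L) : Sym2 (Site d L) := s(p.1, p.1.shift (otherDir i p))

/-- A pair spin product is the bond spin of the plaquette's edge (`L ≥ 2`). [folklore] -/
theorem spinProduct_iSites_eq_bondSpin (hL : 2 ≤ L) (i : Fin d) (p : Plaquette d L) (hp : p.2.1.1 = i ∨ p.2.1.2 = i)
    (ω : Literature.Probability.LatticeModels.SpinConfig (Site d L)) :
    Literature.Probability.LatticeModels.spinProduct (iSites i p) ω = Literature.Probability.LatticeModels.bondSpin ω (edgeOf i p) := by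
  rw [iSites_eq_pair i p hp, Literature.Probability.LatticeModels.spinProduct, Finset.prod_pair (Literature.MathematicalPhysics.QuantumFieldTheory.Balaban1983to89.StrongCouplingTorusWindow.shift_ne_self (by omega) p.1 _).symm, edgeOf,
    Literature.Probability.LatticeModels.bondSpin_mk]

omit [NeZero L] in
/-- The direction pair of a layer plaquette is determined by its other direction. [folklore] -/
theorem dirs_eq_of_otherDir_eq (i : Fin d) {p q : Plaquette d L} (hp : p.2.1.1 = i ∨ p.2.1.2 = i) (hq : q.2.1.1 = i ∨ q.2.1.2 = i)
    (h : otherDir i p = otherDir i q) : p.2 = q.2 := by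
  obtain ⟨z, ⟨⟨a, b⟩, hab⟩⟩ := p
  obtain ⟨z', ⟨⟨a', b'⟩, hab'⟩⟩ := q
  have h1 : a < b := hab
  have h2 : a' < b' := hab'
  unfold otherDir at h
  simp only at hp hq h ⊢
  apply Subtype.ext
  simp only
  split_ifs at h with hpa hqa hqa
  · subst hpa; subst hqa; subst h; rfl
  · rcases hq with hq | hq
    · exact absurd hq hqa
    · subst hpa; subst hq; subst h; exact absurd (h1.trans h2) (lt_irrefl _)
  · rcases hp with hp | hp
    · exact absurd hp hpa
    · subst hqa; subst hp; subst h; exact absurd (h1.trans h2) (lt_irrefl _)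
  · rcases hp with hp | hp
    · exact absurd hp hpa
    · rcases hq with hq | hq
      · exact absurd hq hqa
      · subst hp; subst h; exact Prod.ext rfl (by simpa using hq.symm)

/-- **`edgeOf` is injective on the layer plaquettes** (`L ≥ 3`). [folklore] -/
theorem edgeOf_injOn (hL : 3 ≤ L) (i : Fin d) (H : Finset (ZMod L)) :
    Set.InjOn (edgeOf i) ((layerPlaqs i H : Finset (Plaquette d L)) : Set (Plaquette d L)) := by
  intro p hp q hq h
  have hp' := (mem_layerPlaqs.1 (Finset.mem_coe.1 hp)).1
  have hq' := (mem_layerPlaqs.1 (Finset.mem_coe.1 hq)).1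
  haveI : Fact (1 < L) := ⟨by omega⟩
  unfold edgeOf at h
  rcases Sym2.eq_iff.1 h with ⟨h1, h2⟩ | ⟨h1, h2⟩
  · -- same base point: same other direction, hence same plaquette
    have hv : otherDir i p = otherDir i q := by
      by_contra hne
      have h3 := congrFun h2 (otherDir i p)
      rw [h1] at h3
      simp [Site.shift, Pi.single_eq_of_ne hne] at h3
    exact Prod.ext h1 (dirs_eq_of_otherDir_eq i hp' hq' hv)
  · -- crossed: two unit steps add to zero, impossible for `L ≥ 3`
    exfalso
    have h3 : (q.1.shift (otherDir i q)).shift (otherDir i p) = q.1 := by rw [← h1]; exact h2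
    have h4 := congrFun h3 (otherDir i p)
    by_cases hvw : otherDir i q = otherDir i p
    · rw [hvw] at h4
      simp only [Site.shift, Pi.add_apply, Pi.single_eq_same, add_assoc] at h4
      have h5 : (1 : ZMod L) + 1 = 0 := by simpa using h4
      have h6 : ((2 : ℕ) : ZMod L) = 0 := by rw [show ((2 : ℕ) : ZMod L) = 1 + 1 by push_cast; ring]; exact h5
      rw [ZMod.natCast_eq_zero_iff] at h6
      exact absurd (Nat.le_of_dvd (by norm_num) h6) (by omega)
    · simp only [Site.shift, Pi.add_apply, Pi.single_eq_same, Pi.single_eq_of_ne (Ne.symm hvw), add_assoc] at h4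
      simp at h4

/-- **The edge set of the layer graph is `edgeOf '' layerPlaqs`** (`L ≥ 2`). [folklore] -/
theorem edgeFinset_layerGraph (hL : 2 ≤ L) (i : Fin d) (H : Finset (ZMod L)) :
    (layerGraph i H).edgeFinset = (layerPlaqs i H).image (edgeOf i) := by
  classical
  ext e
  induction e using Sym2.ind with
  | _ y y' =>
    rw [SimpleGraph.mem_edgeFinset, SimpleGraph.mem_edgeSet, layerGraph_adj, Finset.mem_image]
    constructor
    · rintro ⟨-, ⟨p, hp, rfl, rfl⟩ | ⟨p, hp, rfl, rfl⟩⟩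
      · exact ⟨p, hp, rfl⟩
      · exact ⟨p, hp, Sym2.eq_swap⟩
    · rintro ⟨p, hp, he⟩
      unfold edgeOf at he
      rcases Sym2.eq_iff.1 he with ⟨h1, h2⟩ | ⟨h1, h2⟩
      · exact ⟨by rw [← h1, ← h2]; exact (Literature.MathematicalPhysics.QuantumFieldTheory.Balaban1983to89.StrongCouplingTorusWindow.shift_ne_self (by omega) _ _).symm, Or.inl ⟨p, hp, h1.symm, h2.symm⟩⟩
      · exact ⟨by rw [← h1, ← h2]; exact Literature.MathematicalPhysics.QuantumFieldTheory.Balaban1983to89.StrongCouplingTorusWindow.shift_ne_self (by omega) _ _, Or.inr ⟨p, hp, h1.symm, h2.symm⟩⟩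

/-- **THE COMPARISON SYSTEM IS THE ISING MODEL ON THE LAYER GRAPH**: the Friedli–Velenik average with uniform coupling `J₀` on the
plaquette-indexed pairs equals `⟨σ_b σ_t⟩^∅_{univ; J₀}` of the tree's Ising model on `layerGraph i H` (`L ≥ 3`). [folklore] -/
theorem gksExpect_const_eq_isingTwoPoint (hL : 3 ≤ L) (i : Fin d) (H : Finset (ZMod L)) (J₀ : ℝ) (b t : Site d L) :
    Literature.Probability.LatticeModels.gksExpect (layerPlaqs i H) (fun _ => J₀) (iSites i)
        (Literature.Probability.LatticeModels.spinPair b t) =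
      Literature.Probability.LatticeModels.isingTwoPoint (layerGraph i H) Finset.univ J₀ 0 .free b t := by
  classical
  have hL2 : 2 ≤ L := by omega
  rw [Literature.Probability.LatticeModels.isingTwoPoint,
    Literature.Probability.LatticeModels.PairIsing.isingExpect_univ_free_eq_sum_div (layerGraph i H) J₀]
  unfold Literature.Probability.LatticeModels.gksExpect Literature.Probability.LatticeModels.gksSum
    Literature.Probability.LatticeModels.gksWeight Literature.Probability.LatticeModels.gksHamiltonian
  have hexp : ∀ ω : Literature.Probability.LatticeModels.SpinConfig (Site d L),
      ∑ p ∈ layerPlaqs i H, J₀ * Literature.Probability.LatticeModels.spinProduct (iSites i p) ω =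
        J₀ * ∑ e ∈ (layerGraph i H).edgeFinset, Literature.Probability.LatticeModels.bondSpin ω e := by
    intro ω
    rw [Finset.mul_sum, edgeFinset_layerGraph hL2, Finset.sum_image (edgeOf_injOn hL i H)]
    refine Finset.sum_congr rfl fun p hp => ?_
    rw [spinProduct_iSites_eq_bondSpin hL2 i p (mem_layerPlaqs.1 hp).1]
  simp only [hexp, one_mul]

/-! ### The star-rate two-point bound of the `ℤ₂` layer -/

/-- **STAR-RATE TWO-POINT BOUND OF THE CENTRE-PROJECTED `ℤ₂` LAYER** (`L ≥ 4`, no twist defect): for every selected set `H`, transverse `kT`,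
frozen `κ`, background `U` and sites `b, t`:
`‖E ψ₂(σ_b − σ_t)‖ ≤ (2(d−1)(2(d−1)−1) tanh²(2|β|))^{⌊dist_j(t,b)/2⌋}`. [folklore] -/
theorem norm_cavg_ψ_two_le_starRate_pow (hL : 4 ≤ L) (β : ℝ)
    (gD : Fin 0 → (Plaquette d L → ZMod 2) → GaugeConfig d L (SUN 2) → ℝ) (U : GaugeConfig d L (SUN 2)) (i j : Fin d)
    (H : Finset (ZMod L)) (kT : Transverse d L (ZMod 2) i) (κ : Site d L → ZMod 2) (b t : Site d L) :
    ‖FiniteGibbs.cavg (layerWeightW (gS β gD U) i H kT κ) (fun σ => ψ 2 (σ b - σ t))‖ ≤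
      ((((2 * (d - 1) : ℕ) : ℝ)) * (((2 * (d - 1) : ℕ) : ℝ) - 1) * Real.tanh (2 * |β|) ^ 2) ^ (jDist j t b / 2) := by
  classical
  refine (norm_cavg_ψ_two_le_gksExpect_const (by omega) β gD U i H kT κ b t).trans ?_
  rw [gksExpect_const_eq_isingTwoPoint (by omega)]
  exact IsingStar.isingTwoPoint_free_le_starConst_pow (layerGraph i H) (by positivity) (card_neighborFinset_layerGraph_le i H)
    (layerGraph_triangle_free hL i H) (jDist j t) (fun y y' h => jDist_le_of_adj j t h) (jDist_self j t) (Finset.mem_univ t)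
    (jDist j t b / 2) b (Finset.mem_univ b) (by omega)

end ZTwo

end Summit.Ventures.YMGap.RobustBall

end
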